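import Mathlib

/-!
# LatticeQCDFlow / Scaling — transport budget of a push-forward model (T2-O″)

HONEST FRAMING: exact (Metropolis-corrected) sampling algorithms for lattice gauge theory;
figures of merit are autocorrelation/cost numbers at stated couplings and volumes; no
continuum-physics claim.

Venture `LatticeQCDFlow` (cell pub-lqcd), topic `Scaling`, item T2-O″ of HOME/THEORY-2.md §4
(v1.4), landed by FANOUT row 31 from `HOME/THEORY-2-Sketch.lean` (theory seat, decl verbatim).
General measurable spaces (Mathlib measure theory): if the prior `ν` has density `≤ M` w.r.t. a
reference measure `η` (Haar) and the map `T` expands the `η`-volume of preimages by at most `J`,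
then the push-forward model satisfies `(T_* ν)(s) ≤ M · J · η(s)` for every measurable `s`
(`map_apply_le_of_preimage_le`).  Chained with the concentration budget of
`Scaling/SectorBudget.lean` (`p(E) ≥ 1/2 ⇒ ESS ≤ e √(2 q(E))`): `ESS ≤ e √(2 M J η(E_½))` for
every half-mass set of the target — the flow's total volume contraction must beat the
Haar-smallness of the set on which the target concentrates (the COUPLING law of THEORY-2.md §3.2;
the Laplace-type smallness hypothesis (Gβ) is NOT typed here).
-/

namespace Summit.Ventures.LatticeQCDFlow.Theory2

section Transport

open MeasureTheory

/-- **T2-O″ (transport budget, measure form).**  If the prior `ν` has density `≤ M` w.r.t. a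
reference measure `η` (Haar) and the map `T` expands `η`-volume of preimages by at most `J`
(`η(T⁻¹ s) ≤ J·η(s)`; for a diffeomorphism `J = sup |det D(T⁻¹)|` by the change-of-variables
formula, cf. Mathlib `MeasureTheory.addHaar_image_le_mul_of_det_lt`), then the push-forward
model satisfies `(T_* ν)(s) ≤ M·J·η(s)` for every measurable `s`.  [folklore] -/
theorem map_apply_le_of_preimage_le {Ω : Type*} [MeasurableSpace Ω] {ν η : Measure Ω}
    {M J : ENNReal} (hν : ν ≤ M • η) {T : Ω → Ω} (hT : Measurable T)
    (hJ : ∀ s, MeasurableSet s → η (T ⁻¹' s) ≤ J * η s) {s : Set Ω} (hs : MeasurableSet s) :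
    ν.map T s ≤ M * J * η s := by
  rw [Measure.map_apply hT hs]
  calc ν (T ⁻¹' s) ≤ (M • η) (T ⁻¹' s) := Measure.le_iff'.1 hν _
    _ = M * η (T ⁻¹' s) := by rw [Measure.smul_apply, smul_eq_mul]
    _ ≤ M * (J * η s) := by have := hJ s hs; gcongr
    _ = M * J * η s := (mul_assoc _ _ _).symm

end Transport

end Summit.Ventures.LatticeQCDFlow.Theory2
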